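import Mathlib

/-!
# Beta / NeumannPoly — NEUMANN-POLYNOMIAL preconditioners: for ANY `M`, `Mi` in a ring and `n ≥ 0`,
# `M · (Mi · Σ_{j<n} (1 − M Mi)^j) = 1 − (1 − M Mi)^n` and `(Σ_{j<n} (1 − Mi M)^j · Mi) · M = 1 − (1 − Mi M)^n`;
# in a normed ring the residual is bounded by `‖1 − M Mi‖^n` and the preconditioner by `‖Mi‖ · Σ_{j<n} ‖1 − M Mi‖^j`
# (β sub-cell, CAP lane «KERNEL ALGEBRA + EXPORT», lineage `b2b-balaban-beta-cap3`, gen 10; companion of `Beta/SaddleInverseResidual`)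

WHY (the lane's pricing note CAP-KERNEL §4.17, FORM 3).  The Krawczyk form of kernel pairing (`Beta/SaddleInverseResidual`,
`saddle_mul_pairingInv_eq_one_add`) turns a certificate for the saddle inverse on a box of momenta into the inequality
`sup_box ‖𝓔‖ < 1` for a residual `𝓔` whose blocks are the Faddeev–Popov residuals `1 − V(x) Vi`, `1 − Ṽ(x) Wi` times explicit
factors, `Vi`, `Wi` being ARBITRARY.  With a FIXED centre-of-box inverse `Vi = V(x_c)⁻¹` the residual grows linearly across the box;
with the polynomial preconditioner `Vi_n(x) := V(x_c)⁻¹ · Σ_{j<n} (1 − V(x) V(x_c)⁻¹)^j` of this file it is the `n`-th POWER of the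
same linear quantity (`mul_precR`: `V · Vi_n = 1 − (1 − V Vi)^n`, pure algebra), so a box is admissible as soon as
`‖1 − V(x) V(x_c)⁻¹‖ < 1` on it (`norm_one_sub_mul_precR_le`, `norm_precR_le`).  Everything here is [folklore] (the telescoping
identity is Mathlib's `mul_neg_geom_sum` ∕ `geom_sum_mul_neg`); the file only NAMES the objects an engine specification would cite.

## What is proved
* §1 (any `Ring R`) `partialSum D n = Σ_{j<n} D^j`; `one_sub_mul_partialSum`, `partialSum_mul_one_sub` (telescoping);
  `partialSum_zero`∕`_one`, `partialSum_succ` (Horner step `S_{n+1} = 1 + D · S_n`), `partialSum_succ'` (`S_{n+1} = S_n + D^n`), `commute_partialSum`.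
* §2 (any `Ring R`) right and left preconditioners `precR M Mi n := Mi · S_n(1 − M Mi)`, `precL Mi M n := S_n(1 − Mi M) · Mi`;
  `mul_precR : M · precR M Mi n = 1 − (1 − M Mi)^n`, `one_sub_mul_precR`, `mul_precR_sub_one`, `precL_mul`, `one_sub_precL_mul`; `precR_one : precR M Mi 1 = Mi`, `precR_succ`, `precR_of_mul_eq_one` (exact inverse ⇒ `precR = Mi`).
* §3 (any `NormedRing A` with `‖1‖ ≤ 1` where a constant term occurs) `norm_partialSum_le : ‖S_n(D)‖ ≤ Σ_{j<n} ‖D‖^j`,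
  `norm_one_sub_mul_precR_le : ‖1 − M · precR M Mi n‖ ≤ ‖1 − M Mi‖^n` (`n ≥ 1`), `norm_precR_le : ‖precR M Mi n‖ ≤ ‖Mi‖ · Σ_{j<n} ‖1 − M Mi‖^j`,
  the closed form `geom_partialSum_le : 0 ≤ r < 1 ⇒ Σ_{j<n} r^j ≤ (1 − r)⁻¹` and `norm_precR_le_of_lt_one : ‖precR M Mi n‖ ≤ ‖Mi‖ · (1 − ‖1 − M Mi‖)⁻¹`.
The matrix case is the instance `A = Matrix m m ℂ` under `Matrix.Norms.L2Operator` (as in `Beta/SaddleInverseResidual` §3); nothing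
matrix-specific is needed here.

HONEST FRAMING.  Ring identities and normed-ring inequalities, [folklore].  This module proves NO bound on any object of the cell, NO number
of the β-function, NO statement about Bałaban's operators, builds NO engine and discharges NOTHING of `FlowStep.BetaPertH`; the box scales it
enables are a PRICING matter settled by float diagnostics elsewhere (not certificates).  Discharging `BetaPertH` would make Bałaban's
ultraviolet stability unconditional — NOT the continuum limit and NOT the Clay problem.  0 `sorry`, 0 cite tags; imports `Mathlib` only.
-/

namespace Summit.QuantumFields.BalabanUV.Beta.NeumannPoly

open Finset

section Ring

variable {R : Type*} [Ring R]

/-! ## §1 Neumann partial sums -/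

/-- The Neumann partial sum `S_n(D) = Σ_{j<n} D^j`. -/
def partialSum (D : R) (n : ℕ) : R := ∑ j ∈ range n, D ^ j

/-- [folklore] `S_0 = 0`. -/
theorem partialSum_zero (D : R) : partialSum D 0 = 0 := by simp [partialSum]

/-- [folklore] `S_1 = 1`. -/
theorem partialSum_one (D : R) : partialSum D 1 = 1 := by simp [partialSum]

/-- `S_{n+1} = S_n + D^n`. -/
theorem partialSum_succ' (D : R) (n : ℕ) : partialSum D (n + 1) = partialSum D n + D ^ n := by
  simp [partialSum, sum_range_succ]

/-- Horner step `S_{n+1} = 1 + D · S_n`. -/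
theorem partialSum_succ (D : R) (n : ℕ) : partialSum D (n + 1) = 1 + D * partialSum D n := by
  simp only [partialSum, mul_sum]
  rw [sum_range_succ']
  simp [pow_succ', add_comm]

/-- Telescoping: `(1 − D) · S_n(D) = 1 − D^n`. -/
theorem one_sub_mul_partialSum (D : R) (n : ℕ) : (1 - D) * partialSum D n = 1 - D ^ n :=
  mul_neg_geom_sum D n

/-- Telescoping: `S_n(D) · (1 − D) = 1 − D^n`. -/
theorem partialSum_mul_one_sub (D : R) (n : ℕ) : partialSum D n * (1 - D) = 1 - D ^ n :=
  geom_sum_mul_neg D n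

/-- `D` commutes with its own partial sums. -/
theorem commute_partialSum (D : R) (n : ℕ) : Commute D (partialSum D n) :=
  Commute.sum_right _ _ _ fun j _ => Commute.pow_right (Commute.refl D) j

/-! ## §2 Right and left polynomial preconditioners -/

/-- Right Neumann-polynomial preconditioner `Mi · Σ_{j<n} (1 − M Mi)^j` built from ANY approximate inverse `Mi`. -/
def precR (M Mi : R) (n : ℕ) : R := Mi * partialSum (1 - M * Mi) n

/-- Left Neumann-polynomial preconditioner `(Σ_{j<n} (1 − Mi M)^j) · Mi`. -/
def precL (Mi M : R) (n : ℕ) : R := partialSum (1 - Mi * M) n * Mi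

/-- [folklore] degree `0`: `precR M Mi 0 = 0`. -/
theorem precR_zero (M Mi : R) : precR M Mi 0 = 0 := by simp [precR, partialSum_zero]

/-- [folklore] degree `1`: `precR M Mi 1 = Mi` (the plain approximate inverse). -/
theorem precR_one (M Mi : R) : precR M Mi 1 = Mi := by simp [precR, partialSum_one]

/-- [folklore] degree `1`: `precL Mi M 1 = Mi`. -/
theorem precL_one (Mi M : R) : precL Mi M 1 = Mi := by simp [precL, partialSum_one]

/-- Horner step for the right preconditioner: `precR M Mi (n+1) = Mi · (1 + (1 − M Mi) · S_n(1 − M Mi))`. -/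
theorem precR_succ (M Mi : R) (n : ℕ) : precR M Mi (n + 1) = Mi * (1 + (1 - M * Mi) * partialSum (1 - M * Mi) n) := by
  simp [precR, partialSum_succ]

/-- THE IDENTITY: `M · precR M Mi n = 1 − (1 − M Mi)^n` — the residual of the degree-`n` preconditioner is the `n`-th power of the
residual of `Mi`. -/
theorem mul_precR (M Mi : R) (n : ℕ) : M * precR M Mi n = 1 - (1 - M * Mi) ^ n := by
  unfold precR
  rw [← mul_assoc, ← one_sub_mul_partialSum (1 - M * Mi) n, sub_sub_cancel]

/-- [folklore] residual form: `1 − M · precR M Mi n = (1 − M Mi)^n`. -/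
theorem one_sub_mul_precR (M Mi : R) (n : ℕ) : 1 - M * precR M Mi n = (1 - M * Mi) ^ n := by
  rw [mul_precR, sub_sub_cancel]

/-- [folklore] `M · precR M Mi n − 1 = −(1 − M Mi)^n`. -/
theorem mul_precR_sub_one (M Mi : R) (n : ℕ) : M * precR M Mi n - 1 = -((1 - M * Mi) ^ n) := by
  rw [mul_precR]; abel

/-- Left version: `precL Mi M n · M = 1 − (1 − Mi M)^n`. -/
theorem precL_mul (Mi M : R) (n : ℕ) : precL Mi M n * M = 1 - (1 - Mi * M) ^ n := by
  unfold precL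
  rw [mul_assoc, ← partialSum_mul_one_sub (1 - Mi * M) n, sub_sub_cancel]

/-- [folklore] residual form on the left: `1 − precL Mi M n · M = (1 − Mi M)^n`. -/
theorem one_sub_precL_mul (Mi M : R) (n : ℕ) : 1 - precL Mi M n * M = (1 - Mi * M) ^ n := by
  rw [precL_mul, sub_sub_cancel]

/-- `S_{k+1}(0) = 1`. -/
theorem partialSum_zero_left (k : ℕ) : partialSum (0 : R) (k + 1) = 1 := by
  induction k with
  | zero => simp [partialSum]
  | succ k ih => rw [partialSum_succ, ih]; simp

/-- At an exact right inverse every preconditioner of positive degree is `Mi` itself. -/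
theorem precR_of_mul_eq_one {M Mi : R} (h : M * Mi = 1) (k : ℕ) : precR M Mi (k + 1) = Mi := by
  simp only [precR, h, sub_self, partialSum_zero_left, mul_one]

end Ring

/-! ## §3 Norm bounds in a normed ring -/

section Normed

variable {A : Type*} [NormedRing A]

/-- `‖S_n(D)‖ ≤ Σ_{j<n} ‖D‖^j`, given `‖(1 : A)‖ ≤ 1` (true in every `NormOneClass`, and for square complex matrices under the
Euclidean operator norm). -/
theorem norm_partialSum_le (h1 : ‖(1 : A)‖ ≤ 1) (D : A) (n : ℕ) : ‖partialSum D n‖ ≤ ∑ j ∈ range n, ‖D‖ ^ j := by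
  unfold partialSum
  refine (norm_sum_le _ _).trans (sum_le_sum fun j _ => ?_)
  rcases Nat.eq_zero_or_pos j with rfl | hj
  · simpa using h1
  · exact norm_pow_le' D hj

/-- The residual of the degree-`n` right preconditioner: `‖1 − M · precR M Mi n‖ ≤ ‖1 − M Mi‖^n` (`n ≥ 1`). -/
theorem norm_one_sub_mul_precR_le (M Mi : A) {n : ℕ} (hn : 0 < n) : ‖1 - M * precR M Mi n‖ ≤ ‖1 - M * Mi‖ ^ n := by
  rw [one_sub_mul_precR]; exact norm_pow_le' _ hn

/-- The residual of the degree-`n` left preconditioner. -/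
theorem norm_one_sub_precL_mul_le (Mi M : A) {n : ℕ} (hn : 0 < n) : ‖1 - precL Mi M n * M‖ ≤ ‖1 - Mi * M‖ ^ n := by
  rw [one_sub_precL_mul]; exact norm_pow_le' _ hn

/-- Size of the right preconditioner: `‖precR M Mi n‖ ≤ ‖Mi‖ · Σ_{j<n} ‖1 − M Mi‖^j`. -/
theorem norm_precR_le (h1 : ‖(1 : A)‖ ≤ 1) (M Mi : A) (n : ℕ) :
    ‖precR M Mi n‖ ≤ ‖Mi‖ * ∑ j ∈ range n, ‖1 - M * Mi‖ ^ j := by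
  unfold precR
  exact (norm_mul_le _ _).trans (mul_le_mul_of_nonneg_left (norm_partialSum_le h1 _ _) (norm_nonneg _))

/-- Size of the left preconditioner. -/
theorem norm_precL_le (h1 : ‖(1 : A)‖ ≤ 1) (Mi M : A) (n : ℕ) :
    ‖precL Mi M n‖ ≤ (∑ j ∈ range n, ‖1 - Mi * M‖ ^ j) * ‖Mi‖ := by
  unfold precL
  exact (norm_mul_le _ _).trans (mul_le_mul_of_nonneg_right (norm_partialSum_le h1 _ _) (norm_nonneg _))

/-- Closed form of the scalar partial sums: `0 ≤ r < 1 ⇒ Σ_{j<n} r^j ≤ (1 − r)⁻¹`. -/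
theorem geom_partialSum_le {r : ℝ} (h0 : 0 ≤ r) (h1 : r < 1) (n : ℕ) : ∑ j ∈ range n, r ^ j ≤ (1 - r)⁻¹ := by
  have hlt : 0 < 1 - r := sub_pos.mpr h1
  have hS : ∑ j ∈ range n, r ^ j = (1 - r ^ n) / (1 - r) := by
    rw [eq_div_iff hlt.ne']
    exact geom_sum_mul_neg r n
  rw [hS, inv_eq_one_div]
  gcongr
  linarith [pow_nonneg h0 n]

/-- Hence `‖precR M Mi n‖ ≤ ‖Mi‖ · (1 − ‖1 − M Mi‖)⁻¹` whenever `‖1 − M Mi‖ < 1`. -/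
theorem norm_precR_le_of_lt_one (h1 : ‖(1 : A)‖ ≤ 1) (M Mi : A) (n : ℕ) (hlt : ‖1 - M * Mi‖ < 1) :
    ‖precR M Mi n‖ ≤ ‖Mi‖ * (1 - ‖1 - M * Mi‖)⁻¹ :=
  (norm_precR_le h1 M Mi n).trans
    (mul_le_mul_of_nonneg_left (geom_partialSum_le (norm_nonneg _) hlt n) (norm_nonneg _))

end Normed

end Summit.QuantumFields.BalabanUV.Beta.NeumannPoly
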